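import Summits.QuantumFields.BalabanUV.Beta.GAN24.SymContactBorderPartner
import Summits.QuantumFields.BalabanUV.Beta.GAN24.ContactOneGaugeCellBorder

/-!
# `GAN24.SymContactOneGaugeCellBorder` — THE GENERIC BORDER ONE-GAUGE CELL BOUND AND THE TWO V CELLS at an1's symmetrised border table `symVhSAt ρ` — the sym twin
# of leaf-02 g47's (E) `GAN24.ContactOneGaugeCellBorder` (CT-3aV part 2) over `SymContactBorderPartner`
NOT IN PRINT — OUR BOOKKEEPING (OWNER `b2b-balaban-gan24-p1` gen 55, 2026-08-28; row G-an2-4 ∕ (CONV-C), TRANSFER-III, the (III′) S-slot (b), born-V contact letter `hCv` of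
road-P2 M.104 — TABLE HALF at an1's (0.4)-SYMMETRISED border table `symVhSAt ρ` (the type of `SymTables.V` at the literal of record), per the OWNER's design memo
`HCV-DESIGN-g55.md` §1: a mkroot-style token re-run of the (E) file named below with `symVhSAt ρ ↦ symVhSAt ρ`, `linSym04At ρ L ↦ linSym04At ρ L` (entries `lin04KerAt = symLinKerAt`,
an1's `lin04KerAt_eq_symLinKerAt`), the rooted Ward laws ↦ leaf-02 g47's `SymBorderGaugeLegContact` ∕ an1-g42's `SymAveragingWardRootedStencils.divV_symVhSAt_apply`, the kernel
support ∕ size ↦ an1's `symVhKerAt_eq_zero_left ∕ _right`, `symLinKerAt_eq_zero`, `abs_symLinKerAt_le` (SAME window `Near`, SAME bound `ℓ`); every TABLE-FREE lemma of the (E)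
file is consumed BY NAME, not copied.  [folklore] bookkeeping; 0 `def`, 0 cited fact, 0 `def … : Prop`, 0 sorry; NO estimate of Bałaban's beyond an1's DEFINED kernels.
HONEST FRAMING (cell contract, verbatim): «discharging `BetaPertH` makes Bałaban's UV stability UNCONDITIONAL — a real constructive-QFT result; it is NOT the continuum limit
and NOT the Clay problem.»  HONEST DEPENDENCY (verbatim): «continuum YM on T⁴ ⇐ BetaPertH ∧ nine spine estimates (0/9 proved); BetaPertH ⇐ (D1) ∧ (D4) ∧ CAP+tail; G-an2-4
gates asym, D1 and NE2/3/4.»  Discharges NO letter of M.104 ∕ of the OWNER's END `CombChargeRowsOfBornContactLetters` (hCv stays a HYPOTHESIS); NEVER «G-an2-4 closed» as (CONV-C);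
NOT D1, NOT BetaPertH, NOT continuum, NOT Clay.  2026-08-28; no existing file touched.

## What (generic `d`; same statements as the (E) file with `symVhSAt ↦ symVhSAt`, `linSym04At ↦ linSym04At`)
`abs_inner_le`, `abs_cell_border_le`, `cellVflu_eq ∕ abs_cellVflu_le`, `cellVidx_eq ∕ abs_cellVidx_le`.
-/

open Finset
open scoped BigOperators Nat
open Literature.MathematicalPhysics.QuantumFieldTheory.LatticeForm (quo)
open Literature.MathematicalPhysics.QuantumFieldTheory.Balaban1983to89
open Literature.MathematicalPhysics.QuantumFieldTheory.Balaban1983to89.Beta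
open AffineAveraging AveragingContours AveragingHessianKernels AveragingContoursRooted AveragingHessianKernelsRooted
open B12Sec2to5 (l1 l1_nonneg)
open B4ContourShift (supNorm supNorm_nonneg)
open ExpKernelCalculus (MKer Zl Zl_nonneg Zl_pos)
open OneStepResolventKernel (Fib)
open StepJetData (mfNeg mfNeg_inl_inl mfNeg_inl_inr mfNeg_inr_inl mfNeg_inr_inr l1_unitVec)
open KernelWard (divV)
open AveragingWardStencils (b6UnitVec_eq)
open Summit.QuantumFields.BalabanUV.Beta.AveragingWardRootedStencils (legSite legInd legInd_apply)
open Summit.QuantumFields.BalabanUV.Beta.SymAveragingHessianCounts (symVhSAt symVhSAt_symm symVhKerAt_eq_zero_left symVhKerAt_eq_zero_right symLinKerAt_eq_zero abs_symLinKerAt_le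
  locStencil_symVhSAt)
open Summit.QuantumFields.BalabanUV.Beta.SymAveragingWardRootedStencils (lin04KerAt_eq_symLinKerAt)
open Summit.QuantumFields.BalabanUV.Beta.DshAn1 (linSym04At linSym04At_inl_inr linSym04At_inr_inl linSym04At_inl_inl linSym04At_inr_inr linSym04At_symm)
open Summit.QuantumFields.BalabanUV.Beta.SymAveragingHessianCounts (symVhSAt symVhSAt_symm symVhKerAt_eq_zero_left symVhKerAt_eq_zero_right symLinKerAt_eq_zero abs_symLinKerAt_le
  locStencil_symVhSAt)
open Summit.QuantumFields.BalabanUV.Beta.SymAveragingWardRootedStencils (lin04KerAt_eq_symLinKerAt)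
open Summit.QuantumFields.BalabanUV.Beta.DshAn1 (linSym04At linSym04At_inl_inr linSym04At_inr_inl linSym04At_inl_inl linSym04At_inr_inr linSym04At_symm)
open Summit.QuantumFields.BalabanUV.Beta.SymAveragingHessianCounts (symVhSAt symVhSAt_symm symVhKerAt_eq_zero_left symVhKerAt_eq_zero_right symLinKerAt_eq_zero abs_symLinKerAt_le
  locStencil_symVhSAt)
open Summit.QuantumFields.BalabanUV.Beta.SymAveragingWardRootedStencils (lin04KerAt_eq_symLinKerAt divV_symVhSAt_apply)
open Summit.QuantumFields.BalabanUV.Beta.DshAn1 (linSym04At linSym04At_inl_inr linSym04At_inr_inl linSym04At_inl_inl linSym04At_inr_inr linSym04At_symm)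
open Summit.QuantumFields.BalabanUV.Beta.LinearGaugeVH (nearBox mem_nearBox summable_of_finsupp)
open Summit.QuantumFields.BalabanUV.Beta.GAN24.EnvelopeBlockSum (env_wobble env_le_one summable_env)
open Summit.QuantumFields.BalabanUV.Beta.GAN24.ContactOneGaugeCellBound (tsum_env3_le abs_le_of_env summable_of_env)
open Summit.QuantumFields.BalabanUV.Beta.GAN24.BorderGaugeLegContact (tsum_mul_ite_sub_ite_mul tsum_sum_dz_mul_eq)
open Summit.QuantumFields.BalabanUV.Beta.GAN24.SymBorderGaugeLegContact (tsum_dz_mul_symVhSAt symVhSAt_inl_inr_eq_zero_of_not_mem symVhSAt_inr_inl_eq_zero_of_not_mem summable_mul_symVhSAt summable_mul_symVhSAt_right)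
open Summit.QuantumFields.BalabanUV.Beta.GAN24.SymBorderGaugeLegContact (tsum_dz_mul_symVhSAt symVhSAt_inl_inr_eq_zero_of_not_mem symVhSAt_inr_inl_eq_zero_of_not_mem summable_mul_symVhSAt summable_mul_symVhSAt_right)
open Summit.QuantumFields.BalabanUV.Beta.GAN24.SymBorderGaugeLegContact (tsum_dz_mul_symVhSAt symVhSAt_inl_inr_eq_zero_of_not_mem symVhSAt_inr_inl_eq_zero_of_not_mem summable_mul_symVhSAt summable_mul_symVhSAt_right)

open Summit.QuantumFields.BalabanUV.Beta.GAN24.ContactBorderPartner (exists_finset_near_card l1_smul_sub_le_of_mem)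
open Summit.QuantumFields.BalabanUV.Beta.GAN24.SymContactBorderPartner (off_eq_zero_and_near_of_linSym04At_ne_zero tsum_dz_mul_symVhSAt_idx_inl_inr abs_fluWeight_mul_linSym04At_le abs_idxWeight_mul_linSym04At_le)

noncomputable section

namespace Summit.QuantumFields.BalabanUV.Beta.GAN24.SymContactOneGaugeCellBorder

variable {d : ℕ}

/-! ## §3 The generic border cell bound (index leg outer, multiplier leg inside) -/

section Cell

variable {N L : ℕ} {κ₀ : ℝ} {r : Fin (d + 1) → ℕ}

/-- [folklore] **THE INNER (MULTIPLIER-LEG) SUM IS A FINITE BOX SUM AND IS ENVELOPED AT THE LEG SITE**: for a kernel `K κ u μ z` supported where the packed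
first-order kernel is (`z ∈ L·ℤ^(d+1)`, `u` in the box of `z/L`) and bounded by `E_K·E_{z₀}(u)`, and a multiplier leg `|M μ z| ≤ E₃·E_{z₃}(z)`:
`|Σ'_z Σ_μ M μ z · K κ u μ z| ≤ (d+1)·2^{d+1}·e^{2κ₀(d+1)L}·E₃·E_K·E_{z₃}(u)·E_{z₀}(u)` (every contributing `z` is within `|·|₁ ≤ (d+1)·2L` of `u`: one wobble). -/
theorem abs_inner_le (hN : 1 ≤ N) (hκ : 0 ≤ κ₀) (hL : 1 ≤ L) (hr : r ∈ box (d + 1) L) {M : Fin (d + 1) → (Fin (d + 1) → ℤ) → ℝ}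
    {K : Fin (d + 1) → (Fin (d + 1) → ℤ) → Fin (d + 1) → (Fin (d + 1) → ℤ) → ℝ} {z₀ z₃ : Fin (d + 1) → ℤ} {E₃ EK : ℝ} (hE₃ : 0 ≤ E₃) (hEK : 0 ≤ EK)
    (hM : ∀ μ z, |M μ z| ≤ E₃ * Real.exp (-(κ₀ * supNorm (quo N z - z₃))))
    (hKsupp : ∀ κ u μ z, K κ u μ z ≠ 0 → linSym04At (toSite r) L u z (Sum.inl κ) (Sum.inr μ) ≠ 0)
    (hK : ∀ κ u μ z, |K κ u μ z| ≤ EK * Real.exp (-(κ₀ * supNorm (quo N u - z₀)))) (κ : Fin (d + 1)) (u : Fin (d + 1) → ℤ) :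
    (Summable fun z => ∑ μ, M μ z * K κ u μ z) ∧
    |∑' z, ∑ μ, M μ z * K κ u μ z| ≤
      ((d : ℝ) + 1) * 2 ^ (d + 1) * Real.exp (κ₀ * (((d : ℝ) + 1) * (2 * (L : ℝ)))) * E₃ * EK *
        (Real.exp (-(κ₀ * supNorm (quo N u - z₃))) * Real.exp (-(κ₀ * supNorm (quo N u - z₀)))) := by
  classical
  obtain ⟨s, hcard, hs, hprox⟩ := exists_finset_near_card (d := d) hL u
  set S : Finset (Fin (d + 1) → ℤ) := s.image fun y => (L : ℤ) • y with hS
  -- support of the summand in the image of the near-set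
  have hzero : ∀ z ∉ S, (∑ μ, M μ z * K κ u μ z) = 0 := by
    intro z hz
    refine Finset.sum_eq_zero fun μ _ => ?_
    by_cases hKz : K κ u μ z = 0
    · rw [hKz, mul_zero]
    · exfalso
      obtain ⟨hoff, hnear⟩ := off_eq_zero_and_near_of_linSym04At_ne_zero hr (hKsupp κ u μ z hKz)
      exact hz (Finset.mem_image.2 ⟨blk L z, hs _ hnear, (eq_smul_blk_of_off_eq_zero hL hoff).symm⟩)
  have hsum : Summable fun z => ∑ μ, M μ z * K κ u μ z := summable_of_finsupp S hzero
  refine ⟨hsum, ?_⟩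
  rw [tsum_eq_sum (s := S) (fun z hz => hzero z hz)]
  -- uniform bound of each term on `S`
  have hterm : ∀ z ∈ S, |∑ μ, M μ z * K κ u μ z| ≤
      ((d : ℝ) + 1) * (Real.exp (κ₀ * (((d : ℝ) + 1) * (2 * (L : ℝ)))) * E₃ * EK *
        (Real.exp (-(κ₀ * supNorm (quo N u - z₃))) * Real.exp (-(κ₀ * supNorm (quo N u - z₀))))) := by
    intro z hz
    obtain ⟨y, hy, rfl⟩ := Finset.mem_image.1 hz
    have hl1 : l1 ((L : ℤ) • y - u) ≤ ((d : ℝ) + 1) * (2 * (L : ℝ)) := l1_smul_sub_le_of_mem (hprox y hy)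
    have hw : Real.exp (-(κ₀ * supNorm (quo N ((L : ℤ) • y) - z₃)))
        ≤ Real.exp (κ₀ * (((d : ℝ) + 1) * (2 * (L : ℝ)))) * Real.exp (-(κ₀ * supNorm (quo N u - z₃))) := by
      refine (env_wobble hN hκ z₃ u ((L : ℤ) • y)).trans ?_
      gcongr
    calc |∑ μ, M μ ((L : ℤ) • y) * K κ u μ ((L : ℤ) • y)| ≤ ∑ μ, |M μ ((L : ℤ) • y) * K κ u μ ((L : ℤ) • y)| := Finset.abs_sum_le_sum_abs _ _
      _ ≤ ∑ _μ : Fin (d + 1), Real.exp (κ₀ * (((d : ℝ) + 1) * (2 * (L : ℝ)))) * E₃ * EK *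
            (Real.exp (-(κ₀ * supNorm (quo N u - z₃))) * Real.exp (-(κ₀ * supNorm (quo N u - z₀)))) := by
          refine Finset.sum_le_sum fun μ _ => ?_
          rw [abs_mul]
          have h1 := hM μ ((L : ℤ) • y)
          have h2 := hK κ u μ ((L : ℤ) • y)
          have h0 : 0 ≤ |K κ u μ ((L : ℤ) • y)| := abs_nonneg _
          calc |M μ ((L : ℤ) • y)| * |K κ u μ ((L : ℤ) • y)|
              ≤ (E₃ * Real.exp (-(κ₀ * supNorm (quo N ((L : ℤ) • y) - z₃)))) * (EK * Real.exp (-(κ₀ * supNorm (quo N u - z₀)))) :=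
                mul_le_mul h1 h2 h0 (by positivity)
            _ ≤ (E₃ * (Real.exp (κ₀ * (((d : ℝ) + 1) * (2 * (L : ℝ)))) * Real.exp (-(κ₀ * supNorm (quo N u - z₃))))) *
                  (EK * Real.exp (-(κ₀ * supNorm (quo N u - z₀)))) := by gcongr
            _ = _ := by ring
      _ = ((d : ℝ) + 1) * (Real.exp (κ₀ * (((d : ℝ) + 1) * (2 * (L : ℝ)))) * E₃ * EK *
            (Real.exp (-(κ₀ * supNorm (quo N u - z₃))) * Real.exp (-(κ₀ * supNorm (quo N u - z₀))))) := by
          rw [Finset.sum_const, Finset.card_univ, Fintype.card_fin, nsmul_eq_mul]; push_cast; ring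
  have hScard : (S.card : ℝ) ≤ 2 ^ (d + 1) := by
    have h1 : S.card ≤ s.card := Finset.card_image_le
    exact_mod_cast h1.trans hcard
  have hB0 : 0 ≤ ((d : ℝ) + 1) * (Real.exp (κ₀ * (((d : ℝ) + 1) * (2 * (L : ℝ)))) * E₃ * EK *
        (Real.exp (-(κ₀ * supNorm (quo N u - z₃))) * Real.exp (-(κ₀ * supNorm (quo N u - z₀))))) := by positivity
  calc |∑ z ∈ S, ∑ μ, M μ z * K κ u μ z| ≤ ∑ z ∈ S, |∑ μ, M μ z * K κ u μ z| := Finset.abs_sum_le_sum_abs _ _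
    _ ≤ S.card • (((d : ℝ) + 1) * (Real.exp (κ₀ * (((d : ℝ) + 1) * (2 * (L : ℝ)))) * E₃ * EK *
        (Real.exp (-(κ₀ * supNorm (quo N u - z₃))) * Real.exp (-(κ₀ * supNorm (quo N u - z₀)))))) := Finset.sum_le_card_nsmul _ _ _ hterm
    _ ≤ _ := by
        rw [nsmul_eq_mul]
        calc (S.card : ℝ) * (((d : ℝ) + 1) * (Real.exp (κ₀ * (((d : ℝ) + 1) * (2 * (L : ℝ)))) * E₃ * EK *
              (Real.exp (-(κ₀ * supNorm (quo N u - z₃))) * Real.exp (-(κ₀ * supNorm (quo N u - z₀))))))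
            ≤ 2 ^ (d + 1) * (((d : ℝ) + 1) * (Real.exp (κ₀ * (((d : ℝ) + 1) * (2 * (L : ℝ)))) * E₃ * EK *
              (Real.exp (-(κ₀ * supNorm (quo N u - z₃))) * Real.exp (-(κ₀ * supNorm (quo N u - z₀)))))) :=
              mul_le_mul_of_nonneg_right hScard hB0
          _ = _ := by ring

/-- [folklore] **THE GENERIC BORDER CELL BOUND** (index leg OUTER): for an index leg `|T κ u| ≤ E₁·E_{z₁}(u)`, a multiplier leg `|M μ z| ≤ E₃·E_{z₃}(z)` and a contact
kernel `K` supported on the packed kernel's support and bounded by `E_K·E_{z₀}(u)`: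
`|Σ'_u Σ_κ T κ u · Σ'_z Σ_μ M μ z · K κ u μ z| ≤ (d+1)²·2^{d+1}·e^{2κ₀(d+1)L}·E₁E₃E_K·(N^{d+1}·Zl(κ₀∕(4(d+1)))·e^{−(κ₀∕12)(‖z₁−z₀‖∞+‖z₃−z₀‖∞)})` — envelopes in, one free
block sum out (`ContactOneGaugeCellBound.tsum_env3_le`). -/
theorem abs_cell_border_le (hN : 1 ≤ N) (hκ : 0 < κ₀) (hL : 1 ≤ L) (hr : r ∈ box (d + 1) L) {T : Form1 (d + 1) ℝ} {M : Fin (d + 1) → (Fin (d + 1) → ℤ) → ℝ}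
    {K : Fin (d + 1) → (Fin (d + 1) → ℤ) → Fin (d + 1) → (Fin (d + 1) → ℤ) → ℝ} {z₀ z₁ z₃ : Fin (d + 1) → ℤ} {E₁ E₃ EK : ℝ}
    (hE₁ : 0 ≤ E₁) (hE₃ : 0 ≤ E₃) (hEK : 0 ≤ EK)
    (hT : ∀ κ u, |T κ u| ≤ E₁ * Real.exp (-(κ₀ * supNorm (quo N u - z₁))))
    (hM : ∀ μ z, |M μ z| ≤ E₃ * Real.exp (-(κ₀ * supNorm (quo N z - z₃))))
    (hKsupp : ∀ κ u μ z, K κ u μ z ≠ 0 → linSym04At (toSite r) L u z (Sum.inl κ) (Sum.inr μ) ≠ 0)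
    (hK : ∀ κ u μ z, |K κ u μ z| ≤ EK * Real.exp (-(κ₀ * supNorm (quo N u - z₀)))) :
    (Summable fun u => ∑ κ, T κ u * ∑' z, ∑ μ, M μ z * K κ u μ z) ∧
    |∑' u, ∑ κ, T κ u * ∑' z, ∑ μ, M μ z * K κ u μ z| ≤
      ((d : ℝ) + 1) ^ 2 * 2 ^ (d + 1) * Real.exp (κ₀ * (((d : ℝ) + 1) * (2 * (L : ℝ)))) * E₁ * E₃ * EK *
        ((N : ℝ) ^ (d + 1) * Zl (d + 1) (κ₀ / (4 * ((d : ℝ) + 1))) * Real.exp (-(κ₀ / 12) * (supNorm (z₁ - z₀) + supNorm (z₃ - z₀)))) := by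
  set C : ℝ := ((d : ℝ) + 1) * 2 ^ (d + 1) * Real.exp (κ₀ * (((d : ℝ) + 1) * (2 * (L : ℝ)))) * E₃ * EK with hC
  have hC0 : 0 ≤ C := by positivity
  have hin : ∀ κ u, |∑' z, ∑ μ, M μ z * K κ u μ z| ≤
      C * (Real.exp (-(κ₀ * supNorm (quo N u - z₃))) * Real.exp (-(κ₀ * supNorm (quo N u - z₀)))) :=
    fun κ u => (abs_inner_le hN hκ.le hL hr hE₃ hEK hM hKsupp hK κ u).2
  obtain ⟨hPs, hP⟩ := tsum_env3_le (d := d) hN hκ z₀ z₁ z₃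
  set P : (Fin (d + 1) → ℤ) → ℝ := fun u => Real.exp (-(κ₀ * supNorm (quo N u - z₀))) * Real.exp (-(κ₀ * supNorm (quo N u - z₁))) *
        Real.exp (-(κ₀ * supNorm (quo N u - z₃))) with hPdef
  have hpt : ∀ u, |∑ κ, T κ u * ∑' z, ∑ μ, M μ z * K κ u μ z| ≤ ((d : ℝ) + 1) * E₁ * C * P u := by
    intro u
    calc |∑ κ, T κ u * ∑' z, ∑ μ, M μ z * K κ u μ z| ≤ ∑ κ, |T κ u * ∑' z, ∑ μ, M μ z * K κ u μ z| := Finset.abs_sum_le_sum_abs _ _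
      _ ≤ ∑ _κ : Fin (d + 1), E₁ * C * P u := by
          refine Finset.sum_le_sum fun κ _ => ?_
          rw [abs_mul]
          calc |T κ u| * |∑' z, ∑ μ, M μ z * K κ u μ z|
              ≤ (E₁ * Real.exp (-(κ₀ * supNorm (quo N u - z₁)))) *
                  (C * (Real.exp (-(κ₀ * supNorm (quo N u - z₃))) * Real.exp (-(κ₀ * supNorm (quo N u - z₀))))) :=
                mul_le_mul (hT κ u) (hin κ u) (abs_nonneg _) (by positivity)
            _ = E₁ * C * P u := by rw [hPdef]; ring
      _ = ((d : ℝ) + 1) * E₁ * C * P u := by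
          rw [Finset.sum_const, Finset.card_univ, Fintype.card_fin, nsmul_eq_mul]; push_cast; ring
  have hS : Summable fun u => ∑ κ, T κ u * ∑' z, ∑ μ, M μ z * K κ u μ z :=
    Summable.of_norm_bounded (hPs.mul_left (((d : ℝ) + 1) * E₁ * C)) (fun u => by rw [Real.norm_eq_abs]; exact hpt u)
  refine ⟨hS, ?_⟩
  have h1 : |∑' u, ∑ κ, T κ u * ∑' z, ∑ μ, M μ z * K κ u μ z| ≤ ∑' u, ((d : ℝ) + 1) * E₁ * C * P u := by
    refine (norm_tsum_le_tsum_norm hS.norm).trans ?_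
    simp only [Real.norm_eq_abs]
    exact Summable.tsum_le_tsum hpt hS.abs (hPs.mul_left _)
  rw [tsum_mul_left] at h1
  have h2 : ((d : ℝ) + 1) * E₁ * C * ∑' u, P u ≤ ((d : ℝ) + 1) * E₁ * C *
      ((N : ℝ) ^ (d + 1) * Zl (d + 1) (κ₀ / (4 * ((d : ℝ) + 1))) * Real.exp (-(κ₀ / 12) * (supNorm (z₁ - z₀) + supNorm (z₃ - z₀)))) :=
    mul_le_mul_of_nonneg_left hP (by positivity)
  calc |∑' u, ∑ κ, T κ u * ∑' z, ∑ μ, M μ z * K κ u μ z| ≤ ((d : ℝ) + 1) * E₁ * C * ∑' u, P u := h1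
    _ ≤ _ := h2
    _ = _ := by rw [hC]; ring

end Cell

/-! ## §4 The two border cells: gauge in the fluctuation slot, gauge in the index slot -/

section VCells

variable {N L : ℕ} {κ₀ : ℝ} {r : Fin (d + 1) → ℕ}

/-- [folklore] **THE FLUCTUATION-SLOT BORDER CELL, IDENTITY** (box root; a pure-gauge fluctuation leg `dψ` in the table's fluctuation slot, the index leg `T` outer,
the multiplier leg `M` inside): `Σ'_u Σ_κ T κ u · Σ'_z Σ_μ M μ z · (Σ'_x Σ_α (dz ψ) α x · V κ u x z (inl α) (inr μ))
  = Σ'_u Σ_κ T κ u · Σ'_z Σ_μ M μ z · ((ψ(u + e_κ) − ψ(z + ρ + L·e_μ)) · q(u, z)(inl κ)(inr μ))` (no hypothesis on the legs). -/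
theorem cellVflu_eq (hL : 1 ≤ L) (hr : r ∈ box (d + 1) L) (T : Form1 (d + 1) ℝ) (M : Fin (d + 1) → (Fin (d + 1) → ℤ) → ℝ)
    (ψ : (Fin (d + 1) → ℤ) → ℝ) :
    ∑' u, ∑ κ, T κ u * ∑' z, ∑ μ, M μ z * ∑' x, ∑ α, dz ψ α x * symVhSAt (toSite r) d L rfl κ u x z (Sum.inl α) (Sum.inr μ)
      = ∑' u, ∑ κ, T κ u * ∑' z, ∑ μ, M μ z *
          ((ψ (u + unitVec κ) - ψ (z + toSite r + (L : ℤ) • unitVec μ)) * linSym04At (toSite r) L u z (Sum.inl κ) (Sum.inr μ)) := by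
  simp only [tsum_dz_mul_symVhSAt hL hr]

/-- [folklore] **THE FLUCTUATION-SLOT BORDER CELL, BOUND** («envelopes in, `L`-constants·`N^{d+1}·Zl·e^{−κ′·spread}` out):
`|cellVflu| ≤ (d+1)²·2^{d+1}·e^{2κ₀(d+1)L}·E₁E₃·(2Eψ·e^{2κ₀(d+1)L}·ℓ)·(N^{d+1}·Zl(κ₀∕(4(d+1)))·e^{−(κ₀∕12)(‖z₁−z₀‖∞+‖z₃−z₀‖∞)})`. -/
theorem abs_cellVflu_le (hN : 1 ≤ N) (hκ : 0 < κ₀) (hL : 1 ≤ L) (hr : r ∈ box (d + 1) L) {T : Form1 (d + 1) ℝ} {M : Fin (d + 1) → (Fin (d + 1) → ℤ) → ℝ}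
    {ψ : (Fin (d + 1) → ℤ) → ℝ} {z₀ z₁ z₃ : Fin (d + 1) → ℤ} {E₁ E₃ Eψ : ℝ} (hE₁ : 0 ≤ E₁) (hE₃ : 0 ≤ E₃) (hEψ : 0 ≤ Eψ)
    (hT : ∀ κ u, |T κ u| ≤ E₁ * Real.exp (-(κ₀ * supNorm (quo N u - z₁))))
    (hM : ∀ μ z, |M μ z| ≤ E₃ * Real.exp (-(κ₀ * supNorm (quo N z - z₃))))
    (hψ : ∀ x, |ψ x| ≤ Eψ * Real.exp (-(κ₀ * supNorm (quo N x - z₀)))) :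
    |∑' u, ∑ κ, T κ u * ∑' z, ∑ μ, M μ z * ∑' x, ∑ α, dz ψ α x * symVhSAt (toSite r) d L rfl κ u x z (Sum.inl α) (Sum.inr μ)| ≤
      ((d : ℝ) + 1) ^ 2 * 2 ^ (d + 1) * Real.exp (κ₀ * (((d : ℝ) + 1) * (2 * (L : ℝ)))) * E₁ * E₃ *
        (2 * Eψ * Real.exp (κ₀ * (((d : ℝ) + 1) * (2 * (L : ℝ)))) * (ell (d + 1) L : ℝ)) *
        ((N : ℝ) ^ (d + 1) * Zl (d + 1) (κ₀ / (4 * ((d : ℝ) + 1))) * Real.exp (-(κ₀ / 12) * (supNorm (z₁ - z₀) + supNorm (z₃ - z₀)))) := by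
  rw [cellVflu_eq hL hr]
  exact (abs_cell_border_le hN hκ hL hr (K := fun κ u μ z =>
      (ψ (u + unitVec κ) - ψ (z + toSite r + (L : ℤ) • unitVec μ)) * linSym04At (toSite r) L u z (Sum.inl κ) (Sum.inr μ))
    hE₁ hE₃ (by positivity) hT hM (fun κ u μ z h hq => h (by simp only [hq, mul_zero]))
    (fun κ u μ z => abs_fluWeight_mul_linSym04At_le hN hκ.le hL hr hEψ hψ κ u μ z)).2

/-- [folklore] **THE INDEX-SLOT BORDER CELL, IDENTITY** (a pure-gauge background `dψ` in the family index; the fluctuation-slot leg `T` outer, the multiplier leg `M`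
inside): `Σ'_x Σ_α T α x · Σ'_z Σ_μ M μ z · (Σ'_u Σ_κ (dz ψ) κ u · V κ u x z (inl α) (inr μ)) = Σ'_x Σ_α T α x · Σ'_z Σ_μ M μ z · ((ψ(z + ρ) − ψ x) · q(x, z)(inl α)(inr μ))`. -/
theorem cellVidx_eq (hL : 1 ≤ L) (hr : r ∈ box (d + 1) L) (T : Form1 (d + 1) ℝ) (M : Fin (d + 1) → (Fin (d + 1) → ℤ) → ℝ)
    (ψ : (Fin (d + 1) → ℤ) → ℝ) :
    ∑' x, ∑ α, T α x * ∑' z, ∑ μ, M μ z * ∑' u, ∑ κ, dz ψ κ u * symVhSAt (toSite r) d L rfl κ u x z (Sum.inl α) (Sum.inr μ)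
      = ∑' x, ∑ α, T α x * ∑' z, ∑ μ, M μ z * ((ψ (z + toSite r) - ψ x) * linSym04At (toSite r) L x z (Sum.inl α) (Sum.inr μ)) := by
  simp only [tsum_dz_mul_symVhSAt_idx_inl_inr hL hr]

/-- [folklore] **THE INDEX-SLOT BORDER CELL, BOUND** (same letter as the fluctuation-slot cell). -/
theorem abs_cellVidx_le (hN : 1 ≤ N) (hκ : 0 < κ₀) (hL : 1 ≤ L) (hr : r ∈ box (d + 1) L) {T : Form1 (d + 1) ℝ} {M : Fin (d + 1) → (Fin (d + 1) → ℤ) → ℝ}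
    {ψ : (Fin (d + 1) → ℤ) → ℝ} {z₀ z₁ z₃ : Fin (d + 1) → ℤ} {E₁ E₃ Eψ : ℝ} (hE₁ : 0 ≤ E₁) (hE₃ : 0 ≤ E₃) (hEψ : 0 ≤ Eψ)
    (hT : ∀ α x, |T α x| ≤ E₁ * Real.exp (-(κ₀ * supNorm (quo N x - z₁))))
    (hM : ∀ μ z, |M μ z| ≤ E₃ * Real.exp (-(κ₀ * supNorm (quo N z - z₃))))
    (hψ : ∀ x, |ψ x| ≤ Eψ * Real.exp (-(κ₀ * supNorm (quo N x - z₀)))) :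
    |∑' x, ∑ α, T α x * ∑' z, ∑ μ, M μ z * ∑' u, ∑ κ, dz ψ κ u * symVhSAt (toSite r) d L rfl κ u x z (Sum.inl α) (Sum.inr μ)| ≤
      ((d : ℝ) + 1) ^ 2 * 2 ^ (d + 1) * Real.exp (κ₀ * (((d : ℝ) + 1) * (2 * (L : ℝ)))) * E₁ * E₃ *
        (2 * Eψ * Real.exp (κ₀ * (((d : ℝ) + 1) * (2 * (L : ℝ)))) * (ell (d + 1) L : ℝ)) *
        ((N : ℝ) ^ (d + 1) * Zl (d + 1) (κ₀ / (4 * ((d : ℝ) + 1))) * Real.exp (-(κ₀ / 12) * (supNorm (z₁ - z₀) + supNorm (z₃ - z₀)))) := by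
  rw [cellVidx_eq hL hr]
  exact (abs_cell_border_le hN hκ hL hr (K := fun α x μ z =>
      (ψ (z + toSite r) - ψ x) * linSym04At (toSite r) L x z (Sum.inl α) (Sum.inr μ))
    hE₁ hE₃ (by positivity) hT hM (fun α x μ z h hq => h (by simp only [hq, mul_zero]))
    (fun α x μ z => abs_idxWeight_mul_linSym04At_le hN hκ.le hL hr hEψ hψ α x μ z)).2

end VCells

end Summit.QuantumFields.BalabanUV.Beta.GAN24.SymContactOneGaugeCellBorder

end
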